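import Summits.CriticalPhenomena.Ising3D.TaylorRegionCertsHP
import Summits.CriticalPhenomena.Ising3D.TaylorTableEvenHeadFast
import Mathlib.Tactic.Linarith
import HarnessLib

/-!
# Producer-supplied LITERAL rows, checked by containment (kernel-cost repair of the multi-row pieces)
(cell `pub-ising3x`, seat recog-1 gen 11; gate (g2))

HONEST FRAMING: lottery ticket; floor = tightest certified 3D Ising CFT bounds; no exact-solution
claim without a proof. Island framing: certified exclusion region at stated derivative order and
assumptions; not a determination of the 3D Ising critical exponents beyond that.

MEASURED (farm `decide +kernel`, vanilla Λ = 11 table, scale 2^64): a discriminant piece on the COMPUTED rows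
(`d.PX j`, `d.PY j`, `d.PZ j`) costs ≈ 5–6 s whatever the product scheme, but the SAME piece on the same rows written
as LITERAL interval lists costs < 1 s (7 pieces: 21 s file vs 102 s) — the kernel re-reduces the row terms at every
piece of a multi-row test. REPAIR: the certificate carries, per integer `j`, literal interval lists `(LX, LY, LZ)`;
the kernel checks ONCE that the computed rows are contained in them coefficientwise (`subsetI` of boot-1 g7's
`TaylorTableEvenHeadFast`, the same device for the head layer) and runs every piece on
the literals. `EvenRegionDataH.checkPDL d L` (= `checkPD` through literals), **`taylorEvenRegion_of_evenRegionCheckHPDL`**,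
turnkey `EvenRegionCertH.checkPDL`, capstone **`TaylorTable.boxExcluded_of_taylorTable_dec_of_certsHPDL`**, `gammaCheckHPDL`.
Soundness is containment-monotonicity of `PMem`; the literals are untrusted data. Elementary. [folklore]
-/

namespace Summit.CriticalPhenomena.Ising3D

open Finset Set
open Literature.Analysis.ValidatedNumerics Literature.Analysis.ValidatedNumerics.PolyMP
open Literature.Analysis.ValidatedNumerics.NumericsMP (MI)
open Literature.MathematicalPhysics.QuantumFieldTheory.ConformalBootstrap3D

/-! ### Coefficientwise containment: `subsetI` / `pmem_of_subsetI` of `TaylorTableEvenHeadFast` (boot-1 g7) -/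

/-! ### Even check through literal rows -/

namespace EvenRegionDataH

/-- `checkPD` with the per-`j` rows replaced by producer-supplied literals `L[j] = (LX, LY, LZ)` after a containment
check against the computed table rows. [folklore] -/
def checkPDL (d : EvenRegionDataH) (L : List (IPoly × IPoly × IPoly)) : Bool :=
  decide (0 < d.S) && decide (0 < d.E0) && decide (d.E1 ≤ (d.J1 : ℚ) + 1) && momLenOK d.N d.R &&
  kernelSizeOK d.S (d.cQ 0) (-1) d.sσI d.ccQ d.l d.N && kernelSizeOK d.S (d.cQ 1) (-1) d.sεI d.ccQ d.l d.N &&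
  kernelSizeOK d.S (d.cQ 3) (-1) d.sbI d.ccQ d.l d.N && kernelSizeOK d.S (d.cQ 4) 1 d.sbI d.ccQ d.l d.N &&
  decide (1 ≤ d.prmX.θhi) && decide (1 ≤ d.prmY.θhi) && decide (1 ≤ d.prmD.θhi) &&
  halfStripPos2 d.S d.TX (d.E1 - d.ccQ) d.prmX && halfStripPos2 d.S d.TY (d.E1 - d.ccQ) d.prmY &&
  halfStripPosD d.S d.TX d.TY d.TZ (d.E1 - d.ccQ) d.prmD &&
  (List.range (d.J1 + 1)).all fun j =>
    subsetI (d.PX j) (L.getD j ([], [], [])).1 && subsetI (d.PY j) (L.getD j ([], [], [])).2.1 &&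
    subsetI (d.PZ j) (L.getD j ([], [], [])).2.2 &&
    rowPosP d.S d.dPj (L.getD j ([], [], [])).1 d.E0 d.E1 d.ccQ j &&
    rowPosP d.S d.dPj (L.getD j ([], [], [])).2.1 d.E0 d.E1 d.ccQ j &&
    rowPosDP d.S d.dPj (L.getD j ([], [], [])).1 (L.getD j ([], [], [])).2.1 (L.getD j ([], [], [])).2.2 d.E0 d.E1 d.ccQ j

end EvenRegionDataH

/-- **The even region from `checkPDL`** (statement of `taylorEvenRegion_of_evenRegionCheckH`). [folklore] -/
theorem taylorEvenRegion_of_evenRegionCheckHPDL (d : EvenRegionDataH) (L : List (IPoly × IPoly × IPoly))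
    (hl : d.l.Nodup) (Q : Set (ℝ × ℝ))
    (hQ : ∀ p ∈ Q, MI.mem d.S p.1 d.sσI ∧ MI.mem d.S p.2 d.sεI ∧ MI.mem d.S ((p.1 + p.2) / 2) d.sbI)
    (h : d.checkPDL L = true) :
    TaylorEvenRegion (taylorCrossing (1 / 2) (1 / 2) d.l.toFinset fun i ab => (d.cQ i ab : ℝ)) Q ((d.E0 : ℚ) : ℝ) := by
  simp only [EvenRegionDataH.checkPDL, Bool.and_eq_true, decide_eq_true_eq] at h
  obtain ⟨⟨⟨⟨⟨⟨⟨⟨⟨⟨⟨⟨⟨⟨hS, hE0⟩, hJ1⟩, hR⟩, hN0⟩, hN1⟩, hN3⟩, hN4⟩, hθX⟩, hθY⟩, hθD⟩, hX⟩, hY⟩, hD⟩, hrows⟩ := h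
  refine taylorEvenRegion_half_of_qRegion _ _ Q _ fun p hp E j hE hj => ?_
  obtain ⟨hsσ, hsε, hsb⟩ := hQ p hp
  have hEpos : 0 < E := lt_of_lt_of_le (by exact_mod_cast hE0) hE
  by_cases hE1 : ((d.E1 : ℚ) : ℝ) ≤ E
  · have hθ := div_mem_unit hEpos hj
    have hP : ((d.E1 - d.ccQ : ℚ) : ℝ) ≤ E - d.ccQ := by push_cast; linarith
    have eX := qSum_eq_eval2_momTable hS (d.cQ 0) (-1) hsσ d.ccQ hl hN0 hR hEpos j
    have eY := qSum_eq_eval2_momTable hS (d.cQ 1) (-1) hsε d.ccQ hl hN1 hR hEpos j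
    have eZ3 := qSum_eq_eval2_momTable hS (d.cQ 3) (-1) hsb d.ccQ hl hN3 hR hEpos j
    have eZ4 := qSum_eq_eval2_momTable hS (d.cQ 4) 1 hsb d.ccQ hl hN4 hR hEpos j
    have pX := pmem2_momTableI hS (d.cQ 0) (-1) hsσ d.ccQ d.l d.N d.R
    have pY := pmem2_momTableI hS (d.cQ 1) (-1) hsε d.ccQ d.l d.N d.R
    have pZ := pmem2_add2I (pmem2_momTableI hS (d.cQ 3) (-1) hsb d.ccQ d.l d.N d.R)
      (pmem2_momTableI hS (d.cQ 4) 1 hsb d.ccQ d.l d.N d.R)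
    have vX := halfStripPos2_sound hS pX hX hP hθ.1 (hθ.2.trans (by exact_mod_cast hθX))
    have vY := halfStripPos2_sound hS pY hY hP hθ.1 (hθ.2.trans (by exact_mod_cast hθY))
    have vD := halfStripPosD_sound hS pX pY pZ hD hP hθ.1 (hθ.2.trans (by exact_mod_cast hθD))
    rw [eval2_add2] at vD
    simp only [Rat.cast_neg, Rat.cast_one] at eX eY eZ3 eZ4
    have goalD : (qSum (fun ab => (d.cQ 3 ab : ℝ)) d.l.toFinset ((p.1 + p.2) / 2) (-1) E j +
        qSum (fun ab => (d.cQ 4 ab : ℝ)) d.l.toFinset ((p.1 + p.2) / 2) 1 E j) ^ 2 ≤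
        4 * qSum (fun ab => (d.cQ 0 ab : ℝ)) d.l.toFinset p.1 (-1) E j *
          qSum (fun ab => (d.cQ 1 ab : ℝ)) d.l.toFinset p.2 (-1) E j := by
      rw [eX, eY, eZ3, eZ4, sq]; linarith
    exact ⟨by rw [eX]; exact vX.le, by rw [eY]; exact vY.le, goalD⟩
  · have hElt : E < d.E1 := lt_of_not_ge hE1
    have hjJ : j < d.J1 + 1 := by
      have h1 : (j : ℝ) < (d.J1 : ℝ) + 1 := by
        have : ((d.E1 : ℚ) : ℝ) ≤ (d.J1 : ℝ) + 1 := by exact_mod_cast hJ1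
        linarith
      exact_mod_cast h1
    have hrow := List.all_eq_true.mp hrows j (List.mem_range.mpr hjJ)
    simp only [Bool.and_eq_true] at hrow
    obtain ⟨⟨⟨⟨⟨sX, sY⟩, sZ⟩, rX⟩, rY⟩, rD⟩ := hrow
    have pX := pmem_of_subsetI
      (pmem_qRowOfTableI (pmem2_kernelPDLI_of_mem hS hsσ (d.cQ 0) (-1) d.ccQ d.l) d.N j) sX
    have pY := pmem_of_subsetI
      (pmem_qRowOfTableI (pmem2_kernelPDLI_of_mem hS hsε (d.cQ 1) (-1) d.ccQ d.l) d.N j) sY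
    have pZ := pmem_of_subsetI
      (pmem_addI (pmem_qRowOfTableI (pmem2_kernelPDLI_of_mem hS hsb (d.cQ 3) (-1) d.ccQ d.l) d.N j)
        (pmem_qRowOfTableI (pmem2_kernelPDLI_of_mem hS hsb (d.cQ 4) 1 d.ccQ d.l) d.N j)) sZ
    have vX := pos_of_rowPosP hS rX pX hE hj hElt.le
    have vY := pos_of_rowPosP hS rY pY hE hj hElt.le
    have vD := disc_of_rowPosDP hS rD pX pY pZ hE hj hElt.le
    rw [evalR_addR] at vD
    have eX := qSum_eq_evalR_qRowOfTable hS (d.cQ 0) (-1) hsσ d.ccQ hl hN0 E j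
    have eY := qSum_eq_evalR_qRowOfTable hS (d.cQ 1) (-1) hsε d.ccQ hl hN1 E j
    have eZ3 := qSum_eq_evalR_qRowOfTable hS (d.cQ 3) (-1) hsb d.ccQ hl hN3 E j
    have eZ4 := qSum_eq_evalR_qRowOfTable hS (d.cQ 4) 1 hsb d.ccQ hl hN4 E j
    simp only [Rat.cast_neg, Rat.cast_one] at eX eY eZ3 eZ4 vX vY vD
    have goalD : (qSum (fun ab => (d.cQ 3 ab : ℝ)) d.l.toFinset ((p.1 + p.2) / 2) (-1) E j +
        qSum (fun ab => (d.cQ 4 ab : ℝ)) d.l.toFinset ((p.1 + p.2) / 2) 1 E j) ^ 2 ≤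
        4 * qSum (fun ab => (d.cQ 0 ab : ℝ)) d.l.toFinset p.1 (-1) E j *
          qSum (fun ab => (d.cQ 1 ab : ℝ)) d.l.toFinset p.2 (-1) E j := by
      rw [eX, eY, eZ3, eZ4, sq]; linarith
    exact ⟨by rw [eX]; exact vX.le, by rw [eY]; exact vY.le, goalD⟩

/-! ### Turnkey and capstone -/

namespace EvenRegionCertH

/-- Table rows through producer literals, local-product discriminant. [folklore] -/
def checkPDL (c : EvenRegionCertH) (L : List (IPoly × IPoly × IPoly)) : Bool := decide c.l.Nodup && c.data.checkPDL L

end EvenRegionCertH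

/-- [folklore] -/
theorem taylorEvenRegion_of_certHPDL (c : EvenRegionCertH) (L : List (IPoly × IPoly × IPoly)) (h : c.checkPDL L = true) :
    TaylorEvenRegion (taylorCrossing (1 / 2) (1 / 2) c.l.toFinset fun i ab => (c.cQ i ab : ℝ))
      (Icc (c.box.σlo : ℝ) c.box.σhi ×ˢ Icc (c.box.εlo : ℝ) c.box.εhi) ((c.E0 : ℚ) : ℝ) := by
  simp only [EvenRegionCertH.checkPDL, Bool.and_eq_true, decide_eq_true_eq] at h
  obtain ⟨hl, hd⟩ := h
  refine taylorEvenRegion_of_evenRegionCheckHPDL c.data L hl _ (fun p hp => ?_) hd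
  obtain ⟨h1, h2, h3, h4⟩ := BoxQ.bounds (B := c.box) hp
  refine ⟨mem_enclQ _ h1 h2, mem_enclQ _ h3 h4, mem_enclQ _ ?_ ?_⟩
  · push_cast; linarith
  · push_cast; linarith

namespace TaylorTable

variable (T : TaylorTable)

/-- [folklore] -/
theorem evenRegion_of_evenCertHPDL (π : EvenRegionParamsH) (L : List (IPoly × IPoly × IPoly))
    (h : (T.evenCertH π).checkPDL L = true) : TaylorEvenRegion T.α T.box ((T.E₀ : ℚ) : ℝ) :=
  taylorEvenRegion_of_certHPDL (T.evenCertH π) L h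

/-- **All-Boolean capstone, table rows through producer literals.** [folklore] -/
theorem boxExcluded_of_taylorTable_dec_of_certsHPDL (h : T.check = true) (he : T.checkEncl = true)
    (πE : EvenRegionParamsH) (L : List (IPoly × IPoly × IPoly)) (hE : (T.evenCertH πE).checkPDL L = true)
    (πO : OddConeParamsH) (hO : (T.oddCertH πO).checkP = true) : BoxExcluded T.box :=
  T.boxExcluded_of_taylorTable_dec h he (T.evenRegion_of_evenCertHPDL πE L hE) (T.oddCone_of_oddCertHP πO hO)

/-- The four Booleans as ONE (literal even rows). [folklore] -/
def gammaCheckHPDL (πE : EvenRegionParamsH) (L : List (IPoly × IPoly × IPoly)) (πO : OddConeParamsH) : Bool :=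
  T.check && T.checkEncl && (T.evenCertH πE).checkPDL L && (T.oddCertH πO).checkP

/-- [folklore] -/
theorem boxExcluded_of_gammaCheckHPDL (πE : EvenRegionParamsH) (L : List (IPoly × IPoly × IPoly))
    (πO : OddConeParamsH) (h : T.gammaCheckHPDL πE L πO = true) : BoxExcluded T.box := by
  simp only [gammaCheckHPDL, Bool.and_eq_true] at h
  obtain ⟨⟨⟨h1, h2⟩, h3⟩, h4⟩ := h
  exact T.boxExcluded_of_taylorTable_dec_of_certsHPDL h1 h2 πE L h3 πO h4

end TaylorTable

/-! ### Fixture: the toy's own computed rows as literals (containment is reflexive) -/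

/-- The toy hybrid even certificate's rows, recomputed as data. [folklore] -/
def toyEvenLits : List (IPoly × IPoly × IPoly) :=
  (List.range 9).map fun j =>
    (toyEvenRegionCertH.data.PX j, toyEvenRegionCertH.data.PY j, toyEvenRegionCertH.data.PZ j)

/-- [folklore] -/
theorem toyEvenRegionCertH_checkPDL : toyEvenRegionCertH.checkPDL toyEvenLits = true := by
  decide +kernel

end Summit.CriticalPhenomena.Ising3D
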